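/-
Copyright (c) 2026. All rights reserved.
Released under Apache 2.0 license as described in the file LICENSE.
Authors: abc-iut cell — seat abc-iut-w6-d031 (gen 2; block C / W6, self-named row «COR27cf-GENUINE-GROUPLAW»
after L4 RULING #7m), over abc-iut-L4-t12's `HolomorphicEllipticCuspidalization.lean`.
-/
import Literature.AnabelianGeometry.AbsoluteAnabelian.HolomorphicEllipticCuspidalizationFunctorialityGroupLaw
import Literature.AnabelianGeometry.AbsoluteAnabelian.HolomorphicEllipticCuspidalizationFiniteEtaleRigidity
import Literature.Geometry.Kaehler.RiemannSurfaceDegree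
import HarnessLib

/-!
# [AbsTopIII] Cor 2.7 (c)/(f) at the GENUINE punctured elliptic curve: the group law of (c) is unique
# and functorial under (holomorphic homeomorphisms =) finite étale morphisms of degree one

S. Mochizuki, *Topics in absolute anabelian geometry III*, §2, Corollary 2.7, kurims pp. 59–60 (J. Math.
Sci. Univ. Tokyo **22** (2015) pp. 1016–1017; bib key `MochizukiAbsTopIII2015`): (c) «one may construct
the group structure on (the one-point compactification of) `E^top` (that arises from the elliptic curve
determined by `E`) as the unique topological group structure that extends the group structure on the
torsion points of (b)», and the closing sentence (f) «the asserted “functoriality” is with respect to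
finite étale morphisms of Aut-holomorphic orbispaces arising from hyperbolic orbicurves over ℂ».

PROOF-ONLY companion (kind = proof; no definition, no named fact, nothing restated).  The cell's
abc-iut-L4-t8 (`HolomorphicEllipticCuspidalizationGenuineCurve.lean`, p437372) proved, for every punctured
elliptic curve `E` in the typed sense (`TorsionPointsDenseUniqueGroupLaw.IsPuncturedEllipticCurve E`), the
EXISTENCE of a commutative topological group law on `OnePoint E` with `∞ = 0` together with an isomorphism
of topological groups `ψ : OnePoint E ≃ₜ+ ℂ/Φ(ℤ²)` onto a complex torus of the tree that is holomorphic on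
`E` («the elliptic curve determined by `𝔼`»).  Taking exactly that shape as HYPOTHESES (instance binders
`[AddCommGroup (OnePoint E)] [IsTopologicalAddGroup (OnePoint E)]`, `(∞ : OnePoint E) = 0`,
`ψ : OnePoint E ≃ₜ+ ComplexTorus Φ`, `x ↦ ψ x` holomorphic on `E`), this file proves:

* `exists_continuousAddEquiv_eq_onePointCongr` — **(f) for the group laws, at the GENUINE objects**: for
  `E`, `E'` so equipped and ANY holomorphic homeomorphism `γ : E ≃ₜ E'` (holomorphy of `γ⁻¹` is NOT
  assumed: Farkas–Kra I.1.5, the tree's `RiemannSurface.mdifferentiable_symm_of_bijective`), Mathlib's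
  extension `γ.onePointCongr : OnePoint E ≃ₜ OnePoint E'` IS an isomorphism of topological groups
  (`∃ Γ : OnePoint E ≃ₜ+ OnePoint E', ⇑Γ = γ.onePointCongr`); route: `ψ` restricts to a holomorphic
  homeomorphism `e : E ≃ₜ 𝔼_Φ` onto the model punctured torus, with holomorphic inverse; the composite
  `e' ∘ γ ∘ e⁻¹ : 𝔼_Φ ⥲ 𝔼_{Φ'}` is a biholomorphism of punctured tori, hence (this seat's
  `existsUnique_continuousAddEquiv_extends`, p437573: removable singularity + Lange–Birkenhake 1.1.6)
  extends to `Δ : T_Φ ≃ₜ+ T_{Φ'}`, and `Γ := ψ'⁻¹ ∘ Δ ∘ ψ`;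
* `addCommGroup_eq_of_torusModels` — **(c) «the UNIQUE topological group structure (that arises from the
  elliptic curve determined by `E`)», at the GENUINE object**: two such group laws on the SAME `OnePoint E`
  (each with its own torus and its own `ψ`) COINCIDE (the previous theorem at `γ = refl`) — complementing
  the typed uniqueness-from-agreement-on-torsion-points `torsionPoints_groupLaw_unique` (p409175) and
  abc-iut-L4-t8's existence (p437372);
* tools (no definition introduced): `exists_homeomorph_coe_eq` (the restriction `e : E ≃ₜ 𝔼_Φ` of `ψ`,
  with `(e x : T) = ψ x`), `mdifferentiable_of_coe_comp` / `mdifferentiable_symm_of_coe_comp` (it is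
  holomorphic, with holomorphic inverse), `onePointCongr_add` (pointwise additivity).

* `exists_continuousAddEquiv_eq_map_of_isFiniteEtale` — **(f) in full for the `𝔼`-data**: composed with
  the cell's degree-one rigidity (abc-iut-w5-d208, `exists_homeomorph_of_isFiniteEtale_of_isPuncturedEllipticCurve`,
  p438511: a finite étale holomorphic map of typed once-punctured elliptic curves is a biholomorphism), for
  EVERY finite étale holomorphic `g : E → E'` between typed punctured elliptic curves carrying such group laws,
  `OnePoint.map g` is an isomorphism of topological groups.

So these ARE all finite étale morphisms of the `𝔼`-data; the orbispace level of (f) (`X' → X` through the common core `ℍ`, Cor 2.4 (c)) stays the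
untyped FACT-policy junction, as for item (a).  HONEST FRAMING: statements at the genuine typed object
under explicit structure hypotheses (inhabited for every typed `E` by p437372); OUR proofs about OUR typing of
a refereed pre-IUT statement; typed ≠ endorsed; nothing here bears on the disputed [IUTchIII] Cor. 3.12.
-/

noncomputable section

namespace Literature.AnabelianGeometry.AbsoluteAnabelian

namespace HolomorphicEllipticCuspidalization

open _root_.TopologicalSpace _root_.Topology _root_.Set _root_.Function _root_.Filter _root_.OnePoint
open scoped _root_.Manifold _root_.ContDiff
open Literature.Geometry.Kaehler (ComplexTorus)

/-! ### §1 The model homeomorphism `E ≃ₜ 𝔼_Φ` cut out of `ψ : OnePoint E ≃ₜ+ T_Φ` -/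

section Model

variable {E : Type} [TopologicalSpace E] [AddCommGroup (OnePoint E)]
  {ι : Type} [Fintype ι] {Φ : (ι → ℝ) ≃L[ℝ] ℂ}

/-- For `ψ : OnePoint E ≃ₜ+ T` with `∞ = 0`: a point `p` of `OnePoint E` comes from `E` iff `ψ p ≠ 0`.
[cite: MochizukiAbsTopIII2015, Corollary 2.7 (c) p.59] -/
theorem mem_range_coe_iff_map_ne_zero (hinf : (∞ : OnePoint E) = 0) (ψ : OnePoint E ≃ₜ+ ComplexTorus Φ)
    (p : OnePoint E) : p ∈ range ((↑) : E → OnePoint E) ↔ ψ p ∈ (puncturedTorus Φ : Set (ComplexTorus Φ)) := by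
  rw [SetLike.mem_coe, mem_puncturedTorus_iff]
  constructor
  · rintro ⟨x, rfl⟩ h
    have h' : ψ (x : OnePoint E) = ψ 0 := by rw [h, map_zero]
    exact OnePoint.coe_ne_infty x (by rw [ψ.injective h', ← hinf])
  · intro h
    refine OnePoint.ne_infty_iff_exists.1 fun hp => h ?_
    rw [hp, hinf, map_zero]

/-- **The model homeomorphism**: `ψ` restricts to a homeomorphism `e : E ≃ₜ 𝔼_Φ = T_Φ ∖ {0}` with
`(e x : T_Φ) = ψ x` («[the elliptic curve determined by] `E`» minus its origin is `E`).
[cite: MochizukiAbsTopIII2015, Corollary 2.7 (c) p.59] -/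
theorem exists_homeomorph_coe_eq (hinf : (∞ : OnePoint E) = 0) (ψ : OnePoint E ≃ₜ+ ComplexTorus Φ) :
    ∃ e : E ≃ₜ ↥(puncturedTorus Φ), ∀ x : E, ((e x : ↥(puncturedTorus Φ)) : ComplexTorus Φ) = ψ x := by
  let e₁ : E ≃ₜ ↥(range ((↑) : E → OnePoint E)) := OnePoint.isOpenEmbedding_coe.toIsEmbedding.toHomeomorph
  let e₂ : ↥(range ((↑) : E → OnePoint E)) ≃ₜ ↥(puncturedTorus Φ) :=
    ψ.toHomeomorph.subtype (p := fun p => p ∈ range ((↑) : E → OnePoint E))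
      (q := fun t => t ∈ puncturedTorus Φ) (fun p => mem_range_coe_iff_map_ne_zero hinf ψ p)
  exact ⟨e₁.trans e₂, fun x => rfl⟩

end Model

/-! ### §2 Holomorphy of the model homeomorphism and of its inverse -/

section Holomorphy

variable {E : Type} [TopologicalSpace E] [ChartedSpace ℂ E] [IsManifold 𝓘(ℂ, ℂ) ω E]
  {ι : Type} [Fintype ι] {Φ : (ι → ℝ) ≃L[ℝ] ℂ}

omit [IsManifold 𝓘(ℂ, ℂ) ω E] in
/-- A homeomorphism `e : E ≃ₜ 𝔼_Φ` whose composite with `𝔼_Φ ⊆ T_Φ` is holomorphic is holomorphic.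
[cite: MochizukiAbsTopIII2015, Corollary 2.7 (c) p.59] -/
theorem mdifferentiable_of_coe_comp {e : E ≃ₜ ↥(puncturedTorus Φ)} {ψ : OnePoint E → ComplexTorus Φ}
    (he : ∀ x : E, ((e x : ↥(puncturedTorus Φ)) : ComplexTorus Φ) = ψ x)
    (hψ : MDifferentiable 𝓘(ℂ, ℂ) 𝓘(ℂ, ℂ) (fun x : E => ψ x)) :
    MDifferentiable 𝓘(ℂ, ℂ) 𝓘(ℂ, ℂ) e := by
  intro x
  rw [← mdifferentiableAt_subtypeVal_comp_iff (puncturedTorus Φ) (e : E → ↥(puncturedTorus Φ)) x]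
  have hcomp : Subtype.val ∘ (e : E → ↥(puncturedTorus Φ)) = fun x : E => ψ x := funext fun x => he x
  rw [hcomp]
  exact hψ x

/-- … and then so is its inverse (a bijective holomorphic map of a connected Riemann surface is conformal:
Farkas–Kra I.1.5, the tree's `RiemannSurface.mdifferentiable_symm_of_bijective`; `E ≃ₜ 𝔼_Φ` is connected).
[cite: MochizukiAbsTopIII2015, Corollary 2.7 (c) p.59] -/
theorem mdifferentiable_symm_of_coe_comp {e : E ≃ₜ ↥(puncturedTorus Φ)} {ψ : OnePoint E → ComplexTorus Φ}
    (he : ∀ x : E, ((e x : ↥(puncturedTorus Φ)) : ComplexTorus Φ) = ψ x)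
    (hψ : MDifferentiable 𝓘(ℂ, ℂ) 𝓘(ℂ, ℂ) (fun x : E => ψ x)) :
    MDifferentiable 𝓘(ℂ, ℂ) 𝓘(ℂ, ℂ) e.symm := by
  haveI := connectedSpace_puncturedTorus Φ
  haveI : ConnectedSpace E := e.symm.surjective.connectedSpace e.symm.continuous
  exact Literature.Geometry.Kaehler.RiemannSurface.mdifferentiable_symm_of_bijective
    (mdifferentiable_of_coe_comp he hψ) e.bijective e rfl

end Holomorphy

/-! ### §3 (f) at the genuine objects: `γ.onePointCongr` is an isomorphism of topological groups -/

section Functoriality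

variable {E : Type} [TopologicalSpace E] [ChartedSpace ℂ E] [IsManifold 𝓘(ℂ, ℂ) ω E]
  {E' : Type} [TopologicalSpace E'] [ChartedSpace ℂ E']

/-- **[AbsTopIII] Cor 2.7 (f) for the group laws of (c), at the GENUINE objects**: let `E`, `E'` carry
commutative topological group laws on their one-point compactifications with `∞ = 0` that are isomorphic, as
topological groups and holomorphically on `E`, `E'`, to complex tori of the tree (the shape abc-iut-L4-t8's
p437372 provides for every typed punctured elliptic curve).  Then for every HOLOMORPHIC HOMEOMORPHISM
`γ : E ≃ₜ E'` the extension `γ.onePointCongr` to the one-point compactifications is an isomorphism of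
topological groups.  (Holomorphy of `γ⁻¹` is automatic and not assumed.)
[cite: MochizukiAbsTopIII2015, Corollary 2.7 (f) p.60] -/
theorem exists_continuousAddEquiv_eq_onePointCongr
    [AddCommGroup (OnePoint E)] [IsTopologicalAddGroup (OnePoint E)]
    [AddCommGroup (OnePoint E')] [IsTopologicalAddGroup (OnePoint E')]
    (hinf : (∞ : OnePoint E) = 0) (hinf' : (∞ : OnePoint E') = 0)
    {ι : Type} [Fintype ι] {Φ : (ι → ℝ) ≃L[ℝ] ℂ} (ψ : OnePoint E ≃ₜ+ ComplexTorus Φ)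
    (hψ : MDifferentiable 𝓘(ℂ, ℂ) 𝓘(ℂ, ℂ) (fun x : E => ψ x))
    {ι' : Type} [Fintype ι'] {Φ' : (ι' → ℝ) ≃L[ℝ] ℂ} (ψ' : OnePoint E' ≃ₜ+ ComplexTorus Φ')
    (hψ' : MDifferentiable 𝓘(ℂ, ℂ) 𝓘(ℂ, ℂ) (fun x : E' => ψ' x))
    (γ : E ≃ₜ E') (hγ : MDifferentiable 𝓘(ℂ, ℂ) 𝓘(ℂ, ℂ) γ) :
    ∃ Γ : OnePoint E ≃ₜ+ OnePoint E', ∀ p : OnePoint E, Γ p = γ.onePointCongr p := by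
  -- the two model homeomorphisms and their holomorphy
  obtain ⟨e, he⟩ := exists_homeomorph_coe_eq hinf ψ
  obtain ⟨e', he'⟩ := exists_homeomorph_coe_eq hinf' ψ'
  have hed : MDifferentiable 𝓘(ℂ, ℂ) 𝓘(ℂ, ℂ) e.symm := mdifferentiable_symm_of_coe_comp he hψ
  have he'd : MDifferentiable 𝓘(ℂ, ℂ) 𝓘(ℂ, ℂ) e' := mdifferentiable_of_coe_comp he' hψ'
  -- the biholomorphism of punctured tori `δ = e' ∘ γ ∘ e⁻¹`
  let δ : ↥(puncturedTorus Φ) ≃ₜ ↥(puncturedTorus Φ') := e.symm.trans (γ.trans e')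
  have hδ : MDifferentiable 𝓘(ℂ, ℂ) 𝓘(ℂ, ℂ) δ := by
    have : (δ : ↥(puncturedTorus Φ) → ↥(puncturedTorus Φ')) = e' ∘ γ ∘ e.symm := rfl
    rw [this]
    exact he'd.comp (hγ.comp hed)
  -- its additive extension to the compactifications (p437573)
  obtain ⟨Δ, hΔ, -⟩ := existsUnique_continuousAddEquiv_extends δ hδ
  refine ⟨(ψ.trans Δ).trans ψ'.symm, fun p => ?_⟩
  have hψinf : ψ ∞ = 0 := by rw [hinf, map_zero]
  have hψinf' : ψ' ∞ = 0 := by rw [hinf', map_zero]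
  induction p using OnePoint.rec with
  | infty =>
    rw [Homeomorph.onePointCongr_apply, OnePoint.map_infty, ContinuousAddEquiv.trans_apply,
      ContinuousAddEquiv.trans_apply, hψinf, map_zero, ← hψinf', ContinuousAddEquiv.symm_apply_apply]
  | coe x =>
    rw [Homeomorph.onePointCongr_apply, OnePoint.map_some, ContinuousAddEquiv.trans_apply,
      ContinuousAddEquiv.trans_apply, ← he x, hΔ (e x)]
    have hδx : ((δ (e x) : ↥(puncturedTorus Φ')) : ComplexTorus Φ') = ψ' (γ x : OnePoint E') := by
      rw [← he' (γ x)]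
      show (((e.symm.trans (γ.trans e')) (e x) : ↥(puncturedTorus Φ')) : ComplexTorus Φ') = _
      rw [Homeomorph.trans_apply, Homeomorph.trans_apply, e.symm_apply_apply]
    rw [hδx, ContinuousAddEquiv.symm_apply_apply]

/-- Pointwise form: under the hypotheses of `exists_continuousAddEquiv_eq_onePointCongr`, the extension
`γ.onePointCongr` is ADDITIVE for the group laws of (c). [cite: MochizukiAbsTopIII2015, Corollary 2.7 (f) p.60] -/
theorem onePointCongr_add
    [AddCommGroup (OnePoint E)] [IsTopologicalAddGroup (OnePoint E)]
    [AddCommGroup (OnePoint E')] [IsTopologicalAddGroup (OnePoint E')]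
    (hinf : (∞ : OnePoint E) = 0) (hinf' : (∞ : OnePoint E') = 0)
    {ι : Type} [Fintype ι] {Φ : (ι → ℝ) ≃L[ℝ] ℂ} (ψ : OnePoint E ≃ₜ+ ComplexTorus Φ)
    (hψ : MDifferentiable 𝓘(ℂ, ℂ) 𝓘(ℂ, ℂ) (fun x : E => ψ x))
    {ι' : Type} [Fintype ι'] {Φ' : (ι' → ℝ) ≃L[ℝ] ℂ} (ψ' : OnePoint E' ≃ₜ+ ComplexTorus Φ')
    (hψ' : MDifferentiable 𝓘(ℂ, ℂ) 𝓘(ℂ, ℂ) (fun x : E' => ψ' x))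
    (γ : E ≃ₜ E') (hγ : MDifferentiable 𝓘(ℂ, ℂ) 𝓘(ℂ, ℂ) γ) (p q : OnePoint E) :
    γ.onePointCongr (p + q) = γ.onePointCongr p + γ.onePointCongr q := by
  obtain ⟨Γ, hΓ⟩ := exists_continuousAddEquiv_eq_onePointCongr hinf hinf' ψ hψ ψ' hψ' γ hγ
  rw [← hΓ, ← hΓ, ← hΓ, map_add]

end Functoriality

/-! ### §4 (c) at the genuine object: uniqueness of the group law arising from the elliptic curve -/

section Uniqueness

variable {E : Type} [TopologicalSpace E] [ChartedSpace ℂ E] [IsManifold 𝓘(ℂ, ℂ) ω E]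

/-- **[AbsTopIII] Cor 2.7 (c), «the UNIQUE topological group structure (that arises from the elliptic curve
determined by `E`)», at the GENUINE object**: two commutative topological group laws `g₁`, `g₂` on
`OnePoint E` with `∞ = 0`, each isomorphic (as a topological group, holomorphically on `E`) to a complex
torus of the tree, are EQUAL — the identity `(refl E).onePointCongr` is additive from `g₁` to `g₂`.
[cite: MochizukiAbsTopIII2015, Corollary 2.7 (c) p.59] -/
theorem addCommGroup_eq_of_torusModels (g₁ g₂ : AddCommGroup (OnePoint E))
    (top₁ : letI : AddCommGroup (OnePoint E) := g₁; IsTopologicalAddGroup (OnePoint E))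
    (top₂ : letI : AddCommGroup (OnePoint E) := g₂; IsTopologicalAddGroup (OnePoint E))
    (h₁ : letI : AddCommGroup (OnePoint E) := g₁; (∞ : OnePoint E) = 0)
    (h₂ : letI : AddCommGroup (OnePoint E) := g₂; (∞ : OnePoint E) = 0)
    {ι₁ : Type} [Fintype ι₁] {Φ₁ : (ι₁ → ℝ) ≃L[ℝ] ℂ}
    (ψ₁ : letI : AddCommGroup (OnePoint E) := g₁; OnePoint E ≃ₜ+ ComplexTorus Φ₁)
    (hψ₁ : MDifferentiable 𝓘(ℂ, ℂ) 𝓘(ℂ, ℂ) (fun x : E => ψ₁ x))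
    {ι₂ : Type} [Fintype ι₂] {Φ₂ : (ι₂ → ℝ) ≃L[ℝ] ℂ}
    (ψ₂ : letI : AddCommGroup (OnePoint E) := g₂; OnePoint E ≃ₜ+ ComplexTorus Φ₂)
    (hψ₂ : MDifferentiable 𝓘(ℂ, ℂ) 𝓘(ℂ, ℂ) (fun x : E => ψ₂ x)) : g₁ = g₂ := by
  have hid : MDifferentiable 𝓘(ℂ, ℂ) 𝓘(ℂ, ℂ) (Homeomorph.refl E) := fun x => mdifferentiableAt_id
  obtain ⟨Γ, hΓ⟩ := @exists_continuousAddEquiv_eq_onePointCongr E _ _ _ E _ _ g₁ top₁ g₂ top₂ h₁ h₂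
    ι₁ _ Φ₁ ψ₁ hψ₁ ι₂ _ Φ₂ ψ₂ hψ₂ (Homeomorph.refl E) hid
  have hΓid : ∀ p : OnePoint E, Γ p = p := fun p => by
    rw [hΓ p, Homeomorph.onePointCongr_apply]
    show OnePoint.map id p = p
    rw [OnePoint.map_id]
    rfl
  -- the two additions, along the instance paths carried by the type of `Γ`; every instance argument is
  -- passed explicitly (`g₁`, `g₂` are both local instances, so nothing may be left to synthesis)
  refine AddCommGroup.ext ?_
  funext p q
  have h := @AddEquiv.map_add' (OnePoint E) (OnePoint E)
    (@AddCommMagma.toAdd _ (@AddCommSemigroup.toAddCommMagma _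
      (@AddCommMonoid.toAddCommSemigroup _ (@AddCommGroup.toAddCommMonoid _ g₁))))
    (@AddCommMagma.toAdd _ (@AddCommSemigroup.toAddCommMagma _
      (@AddCommMonoid.toAddCommSemigroup _ (@AddCommGroup.toAddCommMonoid _ g₂))))
    (@ContinuousAddEquiv.toAddEquiv (OnePoint E) _ (OnePoint E) _
      (@AddCommMagma.toAdd _ (@AddCommSemigroup.toAddCommMagma _
        (@AddCommMonoid.toAddCommSemigroup _ (@AddCommGroup.toAddCommMonoid _ g₁))))
      (@AddCommMagma.toAdd _ (@AddCommSemigroup.toAddCommMagma _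
        (@AddCommMonoid.toAddCommSemigroup _ (@AddCommGroup.toAddCommMonoid _ g₂)))) Γ) p q
  have h1 : ∀ r : OnePoint E, (@ContinuousAddEquiv.toAddEquiv (OnePoint E) _ (OnePoint E) _
      (@AddCommMagma.toAdd _ (@AddCommSemigroup.toAddCommMagma _
        (@AddCommMonoid.toAddCommSemigroup _ (@AddCommGroup.toAddCommMonoid _ g₁))))
      (@AddCommMagma.toAdd _ (@AddCommSemigroup.toAddCommMagma _
        (@AddCommMonoid.toAddCommSemigroup _ (@AddCommGroup.toAddCommMonoid _ g₂)))) Γ).toFun r = r :=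
    fun r => hΓid r
  rw [h1, h1, h1] at h
  exact h

end Uniqueness

/-! ### §5 (f) in full for the `𝔼`-data: every finite étale holomorphic map of once-punctured elliptic curves
is an isomorphism of topological groups of the compactifications -/

section FiniteEtale

variable {E : Type} [TopologicalSpace E] [T2Space E] [ChartedSpace ℂ E] [IsManifold 𝓘(ℂ, ℂ) ω E]
  {E' : Type} [TopologicalSpace E'] [T2Space E'] [ChartedSpace ℂ E'] [IsManifold 𝓘(ℂ, ℂ) ω E']

/-- **[AbsTopIII] Cor 2.7 (f) for the group laws of (c), for EVERY finite étale morphism of once-punctured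
elliptic curves in the typed sense**: composing the cell's degree-one rigidity (abc-iut-w5-d208's
`exists_homeomorph_of_isFiniteEtale_of_isPuncturedEllipticCurve`, p438511: a finite étale holomorphic
`g : E → E'` between typed punctured elliptic curves is a biholomorphism `e`) with
`exists_continuousAddEquiv_eq_onePointCongr`: the extension `OnePoint.map g` of `g` to the one-point
compactifications is an isomorphism of topological groups for the group laws of (c) (in the shape
abc-iut-L4-t8's p437372 provides). [cite: MochizukiAbsTopIII2015, Corollary 2.7 (f) p.60] -/
theorem exists_continuousAddEquiv_eq_map_of_isFiniteEtale
    [AddCommGroup (OnePoint E)] [IsTopologicalAddGroup (OnePoint E)]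
    [AddCommGroup (OnePoint E')] [IsTopologicalAddGroup (OnePoint E')]
    (hinf : (∞ : OnePoint E) = 0) (hinf' : (∞ : OnePoint E') = 0)
    {ι : Type} [Fintype ι] {Φ : (ι → ℝ) ≃L[ℝ] ℂ} (ψ : OnePoint E ≃ₜ+ ComplexTorus Φ)
    (hψ : MDifferentiable 𝓘(ℂ, ℂ) 𝓘(ℂ, ℂ) (fun x : E => ψ x))
    {ι' : Type} [Fintype ι'] {Φ' : (ι' → ℝ) ≃L[ℝ] ℂ} (ψ' : OnePoint E' ≃ₜ+ ComplexTorus Φ')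
    (hψ' : MDifferentiable 𝓘(ℂ, ℂ) 𝓘(ℂ, ℂ) (fun x : E' => ψ' x))
    (hE : TorsionPointsDenseUniqueGroupLaw.IsPuncturedEllipticCurve E)
    (hE' : TorsionPointsDenseUniqueGroupLaw.IsPuncturedEllipticCurve E')
    {g : E → E'} (hg : IsFiniteEtale g) (dg : MDifferentiable 𝓘(ℂ, ℂ) 𝓘(ℂ, ℂ) g) :
    ∃ Γ : OnePoint E ≃ₜ+ OnePoint E', ∀ p : OnePoint E, Γ p = OnePoint.map g p := by
  obtain ⟨e, heg, he, -⟩ := exists_homeomorph_of_isFiniteEtale_of_isPuncturedEllipticCurve hE hE' hg dg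
  obtain ⟨Γ, hΓ⟩ := exists_continuousAddEquiv_eq_onePointCongr hinf hinf' ψ hψ ψ' hψ' e he
  refine ⟨Γ, fun p => ?_⟩
  rw [hΓ p, Homeomorph.onePointCongr_apply, heg]

end FiniteEtale

end HolomorphicEllipticCuspidalization

end Literature.AnabelianGeometry.AbsoluteAnabelian

end
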